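import Summits.Schanuel.Schanuel.Statement
import Literature.NumberTheory.Transcendental.RoyCriterion
import Literature.NumberTheory.Transcendental.LindemannWeierstrassProofs
import Literature.NumberTheory.Transcendental.PeriodsWave0NesterenkoProofs
import Literature.NumberTheory.Transcendental.GelfondDiazHolds
import Literature.NumberTheory.Transcendental.BWMain
import Literature.Barriers.Schanuel.LargeTranscendenceDegree
import Literature.Barriers.Schanuel.AlgebraicIndependenceOfLogarithms
import Literature.Barriers.Schanuel.NesterenkoModularScopeConjectureProofs
import Literature.Barriers.Schanuel.AxSchanuelFunctionalNotNumericalNarrow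
import Literature.Barriers.Schanuel.AlgebraicIndependenceOfLogarithmsProofs
import Literature.Barriers.Schanuel.NesterenkoModularScopeValuesRhoProofs

/-!
# The unconditional census at rank two: which planes are known to satisfy Schanuel's inequality

Soloist file (`solo-Schanuel-informed`, 2026-08-18, s2). Bookkeeping over transcendence theorems
PROVED in the tree; no new transcendence input. `expField z = ℚ(z, e^z)`; the summit reads
`∀ n z, LinearIndependent ℚ z → n ≤ trdeg (expField z)` (`schanuel_iff_forall_le_trdeg_expField`),
its first open rung `SchanuelRank 2` the same over `Fin 2` (`schanuelRank_iff_forall_…`).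
The inequality depends only on the set `{zᵢ}` (`le_trdeg_expField_comp_equiv`, `_swap`) and holds
as soon as `ℚ(z, e^z)` or an algebraic extension `ℚ(z, e^z)(T)` contains `n` algebraically
independent numbers, or a subfield of transcendence degree `≥ n`
(`le_trdeg_expField_of_algebraicIndependent(_adjoin)`, `le_trdeg_expField_of_le_trdeg_adjoin`).

THE CENSUS AT RANK 2 — the pairs `(z₁, z₂)` with `2 ≤ trdeg ℚ(z₁, z₂, e^{z₁}, e^{z₂})` PROVED:
* (LW) `le_trdeg_expField_of_isAlgebraic`: `z` algebraic, `ℚ`-independent (all ranks;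
  Lindemann–Weierstrass, tree `algebraicIndependent_exp_holds`).
* (N) `two_le_trdeg_expField_pi_cons`, `two_le_trdeg_expField_pi_mul_sqrt_three_cons`: EVERY pair
  `(π, w)` and `(π√3, w)`, `w ∈ ℂ` arbitrary (Nesterenko 1996, Sb. Math. 187, Thm 1 + corollaries:
  `π, e^{π√d}` algebraically independent for all integers `d ≥ 1`; tree `nesterenko_holds` (`d=1`),
  `nesterenko'_holds` (`d = 3`)).
* (G) `two_le_trdeg_expField_gelfond`: `(βλ, β²λ)` with `e^λ` algebraic, `λ ≠ 0`, `β` cubic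
  (Gel'fond 1949 = case `d = 3` of Diaz 1989, J. Number Theory 31, Thm 1; tree `Diaz1989_holds`).
* (BW) `two_le_trdeg_expField_bw`: for `ℚ`-independent logarithms `λ, μ` of algebraic numbers,
  every pair `(t, tμ/λ)` with `(λ, t)` `ℚ`-independent and `λ` algebraic over
  `ℚ(t, tμ/λ, eᵗ, e^{tμ/λ})`; in particular `(λ², λμ)` (`two_le_trdeg_expField_sq_mul`), e.g.
  `(−π², iπ·log 2)` (`two_le_trdeg_expField_neg_pi_sq`) — Brownawell 1974 (J. Number Theory 6) /
  Waldschmidt 1973 (J. Number Theory 5) in the form of Baker, *Transcendental number theory* (1975)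
  Thm 12.2 (tree `BrownawellWaldschmidt.brownawell_waldschmidt`), at `x = (λ, t)`, `y = (1, μ/λ)`.

NOT in the census (open in print; Waldschmidt, *Diophantine approximation on linear algebraic
groups* (2000) §1.4): `(1, iπ)`, `(1, e)`, `(log 2, log 3)`, `(iπ, log 2)`, `(1, log 2)`,
`(log 2, √2·log 2)` — `ℚ(z, e^z)` and its algebraic extensions contain no pair from (LW)–(BW).
-/

noncomputable section

open Complex IntermediateField

namespace Summit.Schanuel.Schanuel.Theorems

/-! ### The field `ℚ(z, e^z)` and Schanuel's inequality at a tuple -/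

/-- The field `ℚ(z₁, …, zₙ, e^{z₁}, …, e^{zₙ})` generated by a tuple and its exponentials. -/
def expField {n : ℕ} (z : Fin n → ℂ) : IntermediateField ℚ ℂ :=
  adjoin ℚ (Set.range z ∪ Set.range (cexp ∘ z))

/-- Rank `l` of Schanuel's conjecture: `l ≤ trdeg (expField z)` for `ℚ`-independent `l`-tuples. -/
theorem schanuelRank_iff_forall_le_trdeg_expField (l : ℕ) :
    Literature.NumberTheory.Transcendental.SchanuelRank l ↔
      ∀ z : Fin l → ℂ, LinearIndependent ℚ z → (l : Cardinal) ≤ Algebra.trdeg ℚ ↥(expField z) :=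
  Iff.rfl

/-- The summit: `n ≤ trdeg (expField z)` for all `ℚ`-independent tuples. -/
theorem schanuel_iff_forall_le_trdeg_expField :
    _root_.Schanuel ↔ ∀ (n : ℕ) (z : Fin n → ℂ), LinearIndependent ℚ z →
      (n : Cardinal) ≤ Algebra.trdeg ℚ ↥(expField z) :=
  Iff.rfl

/-- `zᵢ ∈ ℚ(z, e^z)`. -/
theorem self_mem_expField {n : ℕ} (z : Fin n → ℂ) (i : Fin n) : z i ∈ expField z :=
  subset_adjoin ℚ _ (Or.inl ⟨i, rfl⟩)

/-- `e^{zᵢ} ∈ ℚ(z, e^z)`. -/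
theorem exp_mem_expField {n : ℕ} (z : Fin n → ℂ) (i : Fin n) : cexp (z i) ∈ expField z :=
  subset_adjoin ℚ _ (Or.inr ⟨i, rfl⟩)

/-- `expField` depends only on the set `{z₁, …, zₙ}`: invariance under permuting the tuple. -/
theorem expField_comp_equiv {n : ℕ} (z : Fin n → ℂ) (σ : Equiv.Perm (Fin n)) :
    expField (z ∘ σ) = expField z := by
  have hset : Set.range (z ∘ σ) ∪ Set.range (cexp ∘ (z ∘ σ)) =
      Set.range z ∪ Set.range (cexp ∘ z) := by
    rw [← Function.comp_assoc, σ.surjective.range_comp, σ.surjective.range_comp]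
  unfold expField
  rw [hset]

/-- Schanuel's inequality is invariant under permuting the tuple. -/
theorem le_trdeg_expField_comp_equiv {n : ℕ} (z : Fin n → ℂ) (σ : Equiv.Perm (Fin n))
    (c : Cardinal) :
    c ≤ Algebra.trdeg ℚ ↥(expField (z ∘ σ)) ↔ c ≤ Algebra.trdeg ℚ ↥(expField z) := by
  constructor
  · intro h
    exact h.trans (Literature.Barriers.Schanuel.trdeg_mono (expField_comp_equiv z σ).le)
  · intro h
    exact h.trans (Literature.Barriers.Schanuel.trdeg_mono (expField_comp_equiv z σ).ge)

/-- The pair `(b, a)` satisfies Schanuel's inequality iff `(a, b)` does. -/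
theorem le_trdeg_expField_swap (a b : ℂ) (c : Cardinal) :
    c ≤ Algebra.trdeg ℚ ↥(expField ![b, a]) ↔ c ≤ Algebra.trdeg ℚ ↥(expField ![a, b]) := by
  have h : (![b, a] : Fin 2 → ℂ) = ![a, b] ∘ Equiv.swap (0 : Fin 2) 1 := by
    funext i
    fin_cases i <;> simp
  rw [h]
  exact le_trdeg_expField_comp_equiv _ _ c

/-- **The `n`-element test.** If `ℚ(z, e^z)` contains `n` algebraically independent numbers then
`n ≤ trdeg ℚ(z, e^z)`. -/
theorem le_trdeg_expField_of_algebraicIndependent {n : ℕ} {z : Fin n → ℂ} {w : Fin n → ℂ}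
    (hw : AlgebraicIndependent ℚ w) (hmem : ∀ i, w i ∈ expField z) :
    (n : Cardinal) ≤ Algebra.trdeg ℚ ↥(expField z) :=
  Literature.Barriers.Schanuel.natCast_le_trdeg_of_algebraicIndependent hw hmem

/-- **Test up to an algebraic extension.** If `T` is algebraic over `ℚ(z, e^z)` and `ℚ(z, e^z, T)`
contains `n` algebraically independent numbers, then `n ≤ trdeg ℚ(z, e^z)`. -/
theorem le_trdeg_expField_of_algebraicIndependent_adjoin {n : ℕ} {z : Fin n → ℂ} (T : Set ℂ)
    (hT : ∀ x ∈ T, IsAlgebraic ↥(expField z) x)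
    {w : Fin n → ℂ} (hw : AlgebraicIndependent ℚ w)
    (hmem : ∀ i, w i ∈ adjoin ℚ ((Set.range z ∪ Set.range (cexp ∘ z)) ∪ T)) :
    (n : Cardinal) ≤ Algebra.trdeg ℚ ↥(expField z) := by
  have h1 := Literature.Barriers.Schanuel.natCast_le_trdeg_of_algebraicIndependent hw hmem
  have h2 := Literature.Barriers.Schanuel.trdeg_adjoin_union_eq_of_isAlgebraic_adjoin
    (K := ℚ) (Set.range z ∪ Set.range (cexp ∘ z)) T hT
  exact h1.trans h2.le

/-- **Subfield test.** `F ≤ ℚ(z, e^z, T)`, `T` algebraic over `ℚ(z, e^z)`, `n ≤ trdeg F` suffice. -/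
theorem le_trdeg_expField_of_le_trdeg_adjoin {n : ℕ} {z : Fin n → ℂ} (T : Set ℂ)
    (hT : ∀ x ∈ T, IsAlgebraic ↥(expField z) x)
    {F : IntermediateField ℚ ℂ} (hF : (n : Cardinal) ≤ Algebra.trdeg ℚ ↥F)
    (hle : F ≤ adjoin ℚ ((Set.range z ∪ Set.range (cexp ∘ z)) ∪ T)) :
    (n : Cardinal) ≤ Algebra.trdeg ℚ ↥(expField z) := by
  have h2 := Literature.Barriers.Schanuel.trdeg_adjoin_union_eq_of_isAlgebraic_adjoin
    (K := ℚ) (Set.range z ∪ Set.range (cexp ∘ z)) T hT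
  exact (hF.trans (Literature.Barriers.Schanuel.trdeg_mono hle)).trans h2.le

/-! ### (LW) Algebraic points: Lindemann–Weierstrass -/

/-- **(LW)** `ℚ`-independent algebraic tuples satisfy Schanuel's inequality (Lindemann–W.). -/
theorem le_trdeg_expField_of_isAlgebraic {n : ℕ} (z : Fin n → ℂ) (halg : ∀ i, IsAlgebraic ℚ (z i))
    (hli : LinearIndependent ℚ z) : (n : Cardinal) ≤ Algebra.trdeg ℚ ↥(expField z) :=
  le_trdeg_expField_of_algebraicIndependent
    (Literature.NumberTheory.Transcendental.algebraicIndependent_exp_holds z halg hli)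
    (fun i => exp_mem_expField z i)

/-! ### (N) Pairs through `π` and through `π√3`: Nesterenko -/

/-- `π` and `e^π` are algebraically independent, as complex numbers (Nesterenko 1996: `π, e^π,
Γ(1/4)` are; tree `nesterenko_holds`, first two entries, pushed along `ℝ → ℂ`). -/
private theorem algIndep_ofReal_pi_cexp_pi :
    AlgebraicIndependent ℚ ![(Real.pi : ℂ), cexp (Real.pi : ℂ)] := by
  have h3 := Literature.NumberTheory.Transcendental.nesterenko_holds
  have h2 : AlgebraicIndependent ℚ
      (![Real.pi, Real.exp Real.pi, Real.Gamma (1 / 4)] ∘ Fin.castLE (by norm_num : 2 ≤ 3)) :=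
    h3.comp _ (Fin.castLE_injective _)
  have h2' := h2.map' (f := Complex.ofRealAm.restrictScalars ℚ) Complex.ofReal_injective
  convert h2' using 1
  funext i
  fin_cases i <;> simp [Complex.ofReal_exp]

/-- `π`, `e^{π√3}` are algebraically independent in `ℂ` (Nesterenko 1996; `nesterenko'_holds`). -/
private theorem algIndep_ofReal_pi_cexp_pi_mul_sqrt_three :
    AlgebraicIndependent ℚ ![(Real.pi : ℂ), cexp ((Real.pi : ℂ) * (Real.sqrt 3 : ℂ))] := by
  have h3 := Literature.NumberTheory.Transcendental.nesterenko'_holds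
  have h2 : AlgebraicIndependent ℚ
      (![Real.pi, Real.exp (Real.pi * Real.sqrt 3), Real.Gamma (1 / 3)] ∘
        Fin.castLE (by norm_num : 2 ≤ 3)) :=
    h3.comp _ (Fin.castLE_injective _)
  have h2' := h2.map' (f := Complex.ofRealAm.restrictScalars ℚ) Complex.ofReal_injective
  convert h2' using 1
  funext i
  fin_cases i <;> simp [Complex.ofReal_exp]

/-- **(N), `d = 1`.** Every pair `(π, w)`, `w ∈ ℂ`, satisfies Schanuel's inequality (no hypothesis
on `w`): `π = z₁` and `e^π = e^{z₁}` are already algebraically independent. -/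
theorem two_le_trdeg_expField_pi_cons (w : ℂ) :
    (2 : Cardinal) ≤ Algebra.trdeg ℚ ↥(expField ![(Real.pi : ℂ), w]) :=
  le_trdeg_expField_of_algebraicIndependent (n := 2) algIndep_ofReal_pi_cexp_pi
    (Fin.forall_fin_two.mpr
      ⟨by simpa using self_mem_expField ![(Real.pi : ℂ), w] 0,
        by simpa using exp_mem_expField ![(Real.pi : ℂ), w] 0⟩)

/-- **(N), `d = 3`.** Every pair `(π√3, w)`, `w ∈ ℂ`, satisfies Schanuel's inequality:
`ℚ(π√3, w, e^{π√3}, eʷ)(√3)` contains the algebraically independent numbers `π = (π√3)/√3` and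
`e^{π√3}`, and `√3` is algebraic. -/
theorem two_le_trdeg_expField_pi_mul_sqrt_three_cons (w : ℂ) :
    (2 : Cardinal) ≤ Algebra.trdeg ℚ ↥(expField ![(Real.pi : ℂ) * (Real.sqrt 3 : ℂ), w]) := by
  set z : Fin 2 → ℂ := ![(Real.pi : ℂ) * (Real.sqrt 3 : ℂ), w] with hz
  have hs0 : ((Real.sqrt 3 : ℝ) : ℂ) ≠ 0 := by
    rw [Complex.ofReal_ne_zero]
    exact Real.sqrt_ne_zero'.mpr (by norm_num)
  refine le_trdeg_expField_of_algebraicIndependent_adjoin (n := 2) {((Real.sqrt 3 : ℝ) : ℂ)}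
    (fun x hx => ?_) algIndep_ofReal_pi_cexp_pi_mul_sqrt_three
    (Fin.forall_fin_two.mpr ⟨?_, ?_⟩)
  · rw [Set.mem_singleton_iff] at hx
    subst hx
    exact Literature.Barriers.Schanuel.isAlgebraic_sqrt_three.tower_top _
  · -- `π = (π√3)/√3`
    have h1 : (Real.pi : ℂ) * (Real.sqrt 3 : ℂ) ∈
        adjoin ℚ ((Set.range z ∪ Set.range (cexp ∘ z)) ∪ {((Real.sqrt 3 : ℝ) : ℂ)}) :=
      subset_adjoin ℚ _ (Or.inl (Or.inl ⟨0, by simp [hz]⟩))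
    have h2 : ((Real.sqrt 3 : ℝ) : ℂ) ∈
        adjoin ℚ ((Set.range z ∪ Set.range (cexp ∘ z)) ∪ {((Real.sqrt 3 : ℝ) : ℂ)}) :=
      subset_adjoin ℚ _ (Or.inr rfl)
    have h12 := div_mem h1 h2
    rw [mul_div_assoc, div_self hs0, mul_one] at h12
    simpa using h12
  · simpa [hz] using (subset_adjoin ℚ ((Set.range z ∪ Set.range (cexp ∘ z)) ∪
      {((Real.sqrt 3 : ℝ) : ℂ)}) (Or.inl (Or.inr ⟨0, rfl⟩)))

/-! ### (G) Gel'fond pairs `(βλ, β²λ)`, `β` cubic -/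

/-- **(G)** For `e^λ` algebraic, `λ ≠ 0` and `β` cubic over `ℚ`, the pair `(βλ, β²λ)` satisfies
Schanuel's inequality: `e^{βλ}, e^{β²λ}` are algebraically independent (Gel'fond 1949, the case
`d = 3` of Diaz 1989). -/
theorem two_le_trdeg_expField_gelfond {β l : ℂ} (hl : IsAlgebraic ℚ (cexp l)) (hl0 : l ≠ 0)
    (hβ : (minpoly ℚ β).natDegree = 3) :
    (2 : Cardinal) ≤ Algebra.trdeg ℚ ↥(expField ![β * l, β ^ 2 * l]) := by
  have hβi : IsIntegral ℚ β := by
    by_contra h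
    rw [minpoly.eq_zero h, Polynomial.natDegree_zero] at hβ
    exact absurd hβ (by norm_num)
  have h2 := Literature.NumberTheory.Transcendental.Diaz1989_holds.gelfond1949 hl hβi.isAlgebraic
    rfl hl0 hβ
  refine h2.trans (Literature.Barriers.Schanuel.trdeg_mono (adjoin_le_iff.mpr ?_))
  rintro _ ⟨k, rfl⟩
  rw [SetLike.mem_coe, Literature.NumberTheory.Transcendental.gelfondPowers_apply]
  fin_cases k
  · have h := exp_mem_expField ![β * l, β ^ 2 * l] 0
    simp only [Matrix.cons_val_zero] at h
    convert h using 2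
    simp
  · have h := exp_mem_expField ![β * l, β ^ 2 * l] 1
    simp only [Matrix.cons_val_one] at h
    convert h using 2
    norm_num

/-! ### (BW) Brownawell–Waldschmidt pairs -/

/-- **(BW)** Let `λ, μ` be `ℚ`-linearly independent logarithms of algebraic numbers and `t ∈ ℂ` with
`(λ, t)` `ℚ`-linearly independent and `λ` algebraic over `K = ℚ(t, tμ/λ, eᵗ, e^{tμ/λ})`. Then the
pair `(t, tμ/λ)` satisfies Schanuel's inequality: Brownawell–Waldschmidt for `x = (λ, t)`,
`y = (1, μ/λ)` (`e^{x₁y₁} = e^λ`, `e^{x₁y₂} = e^μ` algebraic) gives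
`trdeg ℚ(λ, t, μ/λ, e^λ, e^μ, eᵗ, e^{tμ/λ}) ≥ 2`, and that field lies in `K(λ, e^λ, e^μ)`, an
algebraic extension of `K`. -/
theorem two_le_trdeg_expField_bw {l m t : ℂ} (hl : IsAlgebraic ℚ (cexp l))
    (hm : IsAlgebraic ℚ (cexp m)) (hlm : LinearIndependent ℚ ![l, m])
    (hlt : LinearIndependent ℚ ![l, t])
    (halg : IsAlgebraic ↥(expField ![t, t * m / l]) l) :
    (2 : Cardinal) ≤ Algebra.trdeg ℚ ↥(expField ![t, t * m / l]) := by
  have hl0 : l ≠ 0 := fun h => hlm.ne_zero 0 (by simp [h])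
  have ht0 : t ≠ 0 := fun h => hlt.ne_zero 1 (by simp [h])
  set z : Fin 2 → ℂ := ![t, t * m / l] with hz
  set S : Set ℂ := Set.range z ∪ Set.range (cexp ∘ z) with hS
  -- the Brownawell–Waldschmidt data
  set x : Fin 2 → ℂ := ![l, t] with hx
  set y : Fin 2 → ℂ := ![1, m / l] with hy
  have hyli : LinearIndependent ℚ y := by
    refine LinearIndependent.pair_iff.mpr fun s r hsr => ?_
    have hsr' : (s : ℂ) + r * (m / l) = 0 := by simpa [Rat.smul_def] using hsr
    have hmul : (s : ℂ) * l + r * m = 0 := by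
      have e : (s : ℂ) * l + r * m = ((s : ℂ) + r * (m / l)) * l := by
        rw [add_mul, mul_assoc, div_mul_cancel₀ m hl0]
      rw [e, hsr', zero_mul]
    exact LinearIndependent.pair_iff.mp hlm s r (by simpa [Rat.smul_def] using hmul)
  have e01 : l * (m / l) = m := by rw [← mul_div_assoc, mul_div_cancel_left₀ m hl0]
  have e11 : t * (m / l) = t * m / l := (mul_div_assoc t m l).symm
  have hBW := Literature.NumberTheory.Transcendental.BrownawellWaldschmidt.brownawell_waldschmidt
    x y hlt hyli (by simpa [hx, hy] using hl) (by simpa [hx, hy, e01] using hm)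
  -- `T = {λ, e^λ, e^μ}` is algebraic over `K = ℚ(S) = expField z`
  set T : Set ℂ := {l, cexp l, cexp m} with hT
  have hTalg : ∀ u ∈ T, IsAlgebraic ↥(expField z) u := by
    intro u hu
    simp only [hT, Set.mem_insert_iff, Set.mem_singleton_iff] at hu
    rcases hu with rfl | rfl | rfl
    · exact halg
    · exact hl.tower_top _
    · exact hm.tower_top _
  refine le_trdeg_expField_of_le_trdeg_adjoin (n := 2) T hTalg hBW ?_
  -- the B–W field lies in `ℚ(S ∪ T)`
  have memS : ∀ u ∈ S, u ∈ adjoin ℚ (S ∪ T) := fun u hu => subset_adjoin ℚ _ (Or.inl hu)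
  have memT : ∀ u ∈ T, u ∈ adjoin ℚ (S ∪ T) := fun u hu => subset_adjoin ℚ _ (Or.inr hu)
  have ht_mem : t ∈ adjoin ℚ (S ∪ T) := memS t (Or.inl ⟨0, by simp [hz]⟩)
  have htm_mem : t * m / l ∈ adjoin ℚ (S ∪ T) := memS _ (Or.inl ⟨1, by simp [hz]⟩)
  have het_mem : cexp t ∈ adjoin ℚ (S ∪ T) := memS _ (Or.inr ⟨0, by simp [hz]⟩)
  have hetm_mem : cexp (t * m / l) ∈ adjoin ℚ (S ∪ T) := memS _ (Or.inr ⟨1, by simp [hz]⟩)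
  have hl_mem : l ∈ adjoin ℚ (S ∪ T) := memT l (by simp [hT])
  have hel_mem : cexp l ∈ adjoin ℚ (S ∪ T) := memT _ (by simp [hT])
  have hem_mem : cexp m ∈ adjoin ℚ (S ∪ T) := memT _ (by simp [hT])
  have hml_mem : m / l ∈ adjoin ℚ (S ∪ T) := by
    have := div_mem htm_mem ht_mem
    rwa [mul_div_assoc, mul_div_cancel_left₀ (m / l) ht0] at this
  rw [adjoin_le_iff]
  rintro u ((⟨i, rfl⟩ | ⟨j, rfl⟩) | ⟨p, rfl⟩)
  · fin_cases i
    · simpa [hx] using hl_mem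
    · simpa [hx] using ht_mem
  · fin_cases j
    · simp [hy]
    · simpa [hy] using hml_mem
  · obtain ⟨i, j⟩ := p
    fin_cases i <;> fin_cases j
    · simpa [hx, hy] using hel_mem
    · simpa [hx, hy, e01] using hem_mem
    · simpa [hx, hy] using het_mem
    · simpa [hx, hy, e11] using hetm_mem

/-- **(BW), the pair `(λ², λμ)`.** For `ℚ`-linearly independent logarithms `λ, μ` of algebraic
numbers, `trdeg ℚ(λ², λμ, e^{λ²}, e^{λμ}) ≥ 2` (`two_le_trdeg_expField_bw` at `t = λ²`: `(λ, λ²)` is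
`ℚ`-independent since `λ` is transcendental, and `λ` is quadratic over `ℚ(λ², …)`). -/
theorem two_le_trdeg_expField_sq_mul {l m : ℂ} (hl : IsAlgebraic ℚ (cexp l))
    (hm : IsAlgebraic ℚ (cexp m)) (hlm : LinearIndependent ℚ ![l, m]) :
    (2 : Cardinal) ≤ Algebra.trdeg ℚ ↥(expField ![l ^ 2, l * m]) := by
  have hl0 : l ≠ 0 := fun h => hlm.ne_zero 0 (by simp [h])
  have hltr : Transcendental ℚ l :=
    Literature.Barriers.Schanuel.transcendental_of_isAlgebraic_cexp hl hl0
  have e : l ^ 2 * m / l = l * m := by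
    rw [sq, mul_assoc, mul_div_assoc, mul_div_cancel_left₀ m hl0]
  have hlt : LinearIndependent ℚ ![l, l ^ 2] := by
    refine LinearIndependent.pair_iff.mpr fun s r hsr => ?_
    have hsr' : (s : ℂ) * l + r * l ^ 2 = 0 := by simpa [Rat.smul_def] using hsr
    have h1 : ((s : ℂ) + r * l) * l = 0 := by rw [← hsr']; ring
    have h2 : (s : ℂ) + r * l = 0 := by
      rcases mul_eq_zero.mp h1 with h | h
      · exact h
      · exact absurd h hl0
    by_cases hr : r = 0
    · subst hr
      have hs : (s : ℂ) = 0 := by simpa using h2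
      exact ⟨by exact_mod_cast hs, rfl⟩
    · exfalso
      apply hltr
      refine ⟨Polynomial.C s + Polynomial.C r * Polynomial.X, fun h0 => ?_, ?_⟩
      · have := congrArg (Polynomial.coeff · 1) h0
        simp [hr] at this
      · simp [h2]
  have hval : (![l ^ 2, l ^ 2 * m / l] : Fin 2 → ℂ) = ![l ^ 2, l * m] := by rw [e]
  have halg : IsAlgebraic ↥(expField ![l ^ 2, l ^ 2 * m / l]) l := by
    refine IsAlgebraic.of_pow (by norm_num : 0 < 2) ?_
    have hmem : l ^ 2 ∈ expField ![l ^ 2, l ^ 2 * m / l] := by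
      simpa using self_mem_expField ![l ^ 2, l ^ 2 * m / l] 0
    exact isAlgebraic_algebraMap (⟨l ^ 2, hmem⟩ : ↥(expField ![l ^ 2, l ^ 2 * m / l]))
  have h := two_le_trdeg_expField_bw hl hm hlm hlt halg
  rwa [hval] at h

/-- `iπ` and `log 2` are `ℚ`-linearly independent (real and imaginary parts). -/
theorem linearIndependent_pi_mul_I_log_two :
    LinearIndependent ℚ ![(Real.pi : ℂ) * I, ((Real.log 2 : ℝ) : ℂ)] := by
  refine LinearIndependent.pair_iff.mpr fun s r hsr => ?_
  rw [Rat.smul_def, Rat.smul_def] at hsr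
  have hre := congrArg Complex.re hsr
  have him := congrArg Complex.im hsr
  simp only [Complex.add_re, Complex.add_im, Complex.mul_re, Complex.mul_im, Complex.ofReal_re,
    Complex.ofReal_im, Complex.I_re, Complex.I_im, Complex.ratCast_re, Complex.ratCast_im,
    Complex.zero_re, Complex.zero_im, mul_zero, zero_mul, sub_zero, sub_self, mul_one, zero_add,
    add_zero] at hre him
  have hlog : Real.log 2 ≠ 0 := (Real.log_pos one_lt_two).ne'
  have hr : (r : ℝ) = 0 := by
    rcases mul_eq_zero.mp hre with h | h
    · exact h
    · exact absurd h hlog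
  have hs : (s : ℝ) = 0 := by
    rcases mul_eq_zero.mp him with h | h
    · exact h
    · exact absurd h Real.pi_ne_zero
  exact ⟨by exact_mod_cast hs, by exact_mod_cast hr⟩

/-- **An emblematic (BW) pair**: `(−π², iπ·log 2)` satisfies Schanuel's inequality —
`trdeg ℚ(π², iπ log 2, e^{−π²}, 2^{iπ}) ≥ 2` (`λ = iπ = log(−1)`, `μ = log 2`). The neighbouring
pair `(iπ, log 2)` itself — algebraic independence of `π` and `log 2` — is open. -/
theorem two_le_trdeg_expField_neg_pi_sq :
    (2 : Cardinal) ≤ Algebra.trdeg ℚ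
      ↥(expField ![-(Real.pi : ℂ) ^ 2, (Real.pi : ℂ) * I * ((Real.log 2 : ℝ) : ℂ)]) := by
  have hl : IsAlgebraic ℚ (cexp ((Real.pi : ℂ) * I)) := by
    rw [Complex.exp_pi_mul_I]
    simpa using isAlgebraic_int (R := ℚ) (A := ℂ) (-1)
  have hm : IsAlgebraic ℚ (cexp ((Real.log 2 : ℝ) : ℂ)) := by
    rw [← Complex.ofReal_exp, Real.exp_log two_pos]
    simpa using isAlgebraic_nat (R := ℚ) (A := ℂ) 2
  have h := two_le_trdeg_expField_sq_mul hl hm linearIndependent_pi_mul_I_log_two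
  have e : (![((Real.pi : ℂ) * I) ^ 2, (Real.pi : ℂ) * I * ((Real.log 2 : ℝ) : ℂ)] : Fin 2 → ℂ) =
      ![-(Real.pi : ℂ) ^ 2, (Real.pi : ℂ) * I * ((Real.log 2 : ℝ) : ℂ)] := by
    rw [mul_pow, Complex.I_sq, mul_neg_one]
  rwa [e] at h

end Summit.Schanuel.Schanuel.Theorems
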